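import Literature.Probability.LatticeModels.IsingConsistency
import Literature.Probability.LatticeModels.GriffithsMonotonicity
import Literature.Probability.LatticeModels.GriffithsKellySherman
import HarnessLib

/-!
# Unfixing one spin: the single-site conditioning identity, spin flip of general observables,
# and a GKS lower bound for `⟨e^{tS} - e^{-tS}⟩⁺`

Topic `Probability/LatticeModels`. Elementary finite-volume identities for the nearest-neighbour
Ising model `μ^{η}_{Λ;β,h}` of `IsingModel` on an arbitrary locally finite graph, at zero field,
which make up Step 3 ("unfixing of the spin at the origin") of the Griffiths–Pearce–Israel
argument of van Enter–Fernández–Sokal (J. Stat. Phys. 72 (1993), §4.1.2, eqs. (4.7)–(4.13)):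

* `isingWeight_fixed_update` — changing one boundary spin `η_z ↦ u` (`z ∉ Λ`) tilts the Boltzmann
  weight by `exp(β (u - η_z) S_z)`, `S_z = ∑_{y ∈ Λ, y ∼ z} σ_y` (`nbrSum`) the neighbour sum;
* `isingExpect_spinAt_insert_eq` — **the conditioning identity** (4.7): for `z ∉ Λ` with all its
  neighbours in `Λ` and `η_z = +1`,
  `⟨σ_z⟩^{η}_{Λ ∪ {z};β,0} = (1 - x)/(1 + x)`, `x = ⟨e^{-2β S_z}⟩^{η}_{Λ;β,0}` — the system with the
  spin at `z` free in terms of the system where it is a `+` boundary spin (proved from the tree's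
  two-step decomposition of the Boltzmann sums, `sum_isingWeight_fixed_eq_sum_sum`);
* `isingExpect_fixed_neg_bc` — global spin flip for a general observable,
  `⟨f⟩^{-η}_{Λ;β,0} = ⟨f(-·)⟩^{η}_{Λ;β,0}` ((4.8));
* `exp_mul_spinTotal_eq_sum`, `isingExpect_exp_spinTotal_sub_ge` — the expansion
  `e^{t S_N} = ∑_{A ⊆ N} cosh^{|N∖A|} t sinh^{|A|} t σ_A` and, by the first Griffiths inequality in a
  `+` state, `⟨e^{t S_N} - e^{-t S_N}⟩⁺ ≥ 2 cosh^{|N|-1} t · sinh t · ⟨σ_{y₀}⟩⁺` for `y₀ ∈ N ⊆ Λ`,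
  `t, β ≥ 0` ((4.12): only odd powers survive, "the contributions from `k = 3, 5, …` are all
  nonnegative by Griffiths' first inequality").

## References

* A. C. D. van Enter, R. Fernández, A. D. Sokal, *Regularity properties and pathologies of
  position-space renormalization-group transformations*, J. Stat. Phys. 72 (1993) 879–1167,
  §4.1.2 Step 3.
* S. Friedli, Y. Velenik, *Statistical Mechanics of Lattice Systems* (CUP 2017), §3.1, §3.6.2
  (GKS), §3.7.1 (spin flip), Lemma 6.7 (two-step Boltzmann sums).
-/

noncomputable section

open MeasureTheory Finset

namespace Literature.Probability.LatticeModels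

variable {V : Type*} (G : SimpleGraph V) [DecidableEq V] [G.LocallyFinite]

/-! ### The neighbour sum of a site -/

/-- The sum of the spins of the `G`-neighbours of `z` lying in `Λ`, `S_z(σ) = ∑_{y ∈ Λ, y ∼ z} σ_y`
(the "effective field" variable of van Enter–Fernández–Sokal §4.1.2 Step 3, eq. (4.7):
`σ_{0,1} + σ_{0,-1} + σ_{1,0} + σ_{-1,0}`). [cite: VanenterFernandezSokal1993, §4.1.2 Step 3, eq. (4.7)] -/
def nbrSum (Λ : Finset V) (z : V) (σ : SpinConfig V) : ℝ :=
  ∑ y ∈ Λ ∩ G.neighborFinset z, spinAt y σ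

/-- `S_z` is measurable. [folklore] -/
@[fun_prop]
theorem measurable_nbrSum (Λ : Finset V) (z : V) : Measurable (nbrSum G Λ z) :=
  Finset.measurable_sum _ fun y _ => measurable_spinAt y

omit [DecidableEq V] [G.LocallyFinite] in
/-- `S_z` reads only the spins in `Λ`. [folklore] -/
theorem nbrSum_congr [DecidableEq V] [G.LocallyFinite] (Λ : Finset V) (z : V) {σ σ' : SpinConfig V}
    (h : ∀ x ∈ Λ, σ x = σ' x) : nbrSum G Λ z σ = nbrSum G Λ z σ' :=
  Finset.sum_congr rfl fun y hy => by simp only [spinAt, h y (Finset.mem_inter.1 hy).1]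

/-- `|S_z| ≤ #{y ∈ Λ | y ∼ z} ≤ deg z`. [folklore] -/
theorem abs_nbrSum_le (Λ : Finset V) (z : V) (σ : SpinConfig V) :
    |nbrSum G Λ z σ| ≤ #(G.neighborFinset z) := by
  unfold nbrSum
  calc |∑ y ∈ Λ ∩ G.neighborFinset z, spinAt y σ| ≤ ∑ y ∈ Λ ∩ G.neighborFinset z, |spinAt y σ| :=
        Finset.abs_sum_le_sum_abs _ _
    _ ≤ ∑ y ∈ Λ ∩ G.neighborFinset z, (1 : ℝ) := Finset.sum_le_sum fun y _ => by
        rcases spinAt_eq_one_or_eq_neg_one y σ with h | h <;> simp [h]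
    _ = #(Λ ∩ G.neighborFinset z) := by simp
    _ ≤ #(G.neighborFinset z) := by exact_mod_cast Finset.card_le_card Finset.inter_subset_right

/-- `S_z` is nondecreasing in the configuration. [folklore] -/
theorem nbrSum_mono (Λ : Finset V) (z : V) : Monotone (nbrSum G Λ z) :=
  fun _ _ h => Finset.sum_le_sum fun y _ => spinAt_mono y h

/-- `S_z(-σ) = -S_z(σ)`. [folklore] -/
theorem nbrSum_neg (Λ : Finset V) (z : V) (σ : SpinConfig V) :
    nbrSum G Λ z (-σ) = -nbrSum G Λ z σ := by
  simp only [nbrSum, spinAt_neg, Finset.sum_neg_distrib]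

/-! ### Changing the boundary condition at a single outside site -/

/-- The edges touching `Λ` and containing the outside site `z` are the bonds `{z, y}`, `y ∈ Λ`,
`y ∼ z`. [folklore] -/
theorem filter_mem_edgesTouching_eq_image {Λ : Finset V} {z : V} (hz : z ∉ Λ) :
    (edgesTouching G Λ).filter (fun e => z ∈ e) =
      (Λ ∩ G.neighborFinset z).image fun y => s(z, y) := by
  ext e
  simp only [Finset.mem_filter, mem_edgesTouching_iff, Finset.mem_image, Finset.mem_inter,
    SimpleGraph.mem_neighborFinset]
  constructor
  · rintro ⟨⟨he, x, hx, hxe⟩, hze⟩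
    have hxz : x ≠ z := fun h => hz (h ▸ hx)
    have hexz : e = s(x, z) := (Sym2.mem_and_mem_iff hxz).1 ⟨hxe, hze⟩
    subst hexz
    exact ⟨x, ⟨hx, ((SimpleGraph.mem_edgeSet G).1 he).symm⟩, Sym2.eq_swap⟩
  · rintro ⟨y, ⟨hy, hadj⟩, rfl⟩
    exact ⟨⟨(SimpleGraph.mem_edgeSet G).2 hadj, y, hy, Sym2.mem_mk_right z y⟩, Sym2.mem_mk_left z y⟩

omit [DecidableEq V] [G.LocallyFinite] in
/-- Updating the spin at `z` does not change the bond observable of a pair avoiding `z`. [folklore] -/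
theorem bondSpin_update_of_not_mem [DecidableEq V] (σ : SpinConfig V) (z : V) (u : ℤˣ) {e : Sym2 V}
    (he : z ∉ e) : bondSpin (Function.update σ z u) e = bondSpin σ e := by
  induction e using Sym2.ind with
  | _ a b =>
    have ha : a ≠ z := fun h => he (h ▸ Sym2.mem_mk_left a b)
    have hb : b ≠ z := fun h => he (h ▸ Sym2.mem_mk_right a b)
    simp [bondSpin_mk, spinAt, Function.update_of_ne ha, Function.update_of_ne hb]

/-- **The bond sum under a change of one outside spin.** For `z ∉ Λ`,
`∑_{e ∈ ℰ^b_Λ} σ_e(σ[z ↦ u]) - ∑_{e ∈ ℰ^b_Λ} σ_e(σ) = (u - σ_z) S_z(σ)`: only the bonds `{z, y}`,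
`y ∈ Λ`, feel the change (cf. van Enter–Fernández–Sokal eq. (4.7), the factor
`exp[J(σ_{0,0} - 1)(σ_{0,1} + σ_{0,-1} + σ_{1,0} + σ_{-1,0})]`).
[cite: VanenterFernandezSokal1993, §4.1.2 Step 3, eq. (4.7)] -/
theorem sum_bondSpin_update_sub {Λ : Finset V} {z : V} (hz : z ∉ Λ) (σ : SpinConfig V) (u : ℤˣ) :
    ∑ e ∈ edgesTouching G Λ, bondSpin (Function.update σ z u) e -
        ∑ e ∈ edgesTouching G Λ, bondSpin σ e =
      (((u : ℤ) : ℝ) - spinAt z σ) * nbrSum G Λ z σ := by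
  rw [← Finset.sum_sub_distrib,
    ← Finset.sum_filter_add_sum_filter_not (edgesTouching G Λ) (fun e => z ∈ e)]
  have hrest : ∑ e ∈ (edgesTouching G Λ).filter (fun e => z ∉ e),
      (bondSpin (Function.update σ z u) e - bondSpin σ e) = 0 :=
    Finset.sum_eq_zero fun e he => by
      rw [bondSpin_update_of_not_mem σ z u (Finset.mem_filter.1 he).2, sub_self]
  rw [hrest, add_zero, filter_mem_edgesTouching_eq_image G hz, Finset.sum_image]
  · rw [nbrSum, Finset.mul_sum]
    refine Finset.sum_congr rfl fun y hy => ?_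
    have hyz : y ≠ z := fun h => hz (h ▸ (Finset.mem_inter.1 hy).1)
    simp only [bondSpin_mk, spinAt, Function.update_self, Function.update_of_ne hyz]
    ring
  · intro y _ y' _ h
    exact Sym2.congr_right.1 h

/-- **The Boltzmann weight under a change of one boundary spin** (zero field): for `z ∉ Λ`,
`w^{η[z ↦ u]}_Λ(τ) = w^{η}_Λ(τ) · exp(β (u - η_z) S_z(τ·η))`.
[cite: VanenterFernandezSokal1993, §4.1.2 Step 3, eq. (4.7)] -/
theorem isingWeight_fixed_update {Λ : Finset V} {z : V} (hz : z ∉ Λ) (β : ℝ) (η : SpinConfig V)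
    (u : ℤˣ) (τ : Λ → ℤˣ) :
    isingWeight G Λ β 0 (.fixed (Function.update η z u)) τ =
      isingWeight G Λ β 0 (.fixed η) τ *
        Real.exp (β * ((((u : ℤ) : ℝ) - spinAt z η) * nbrSum G Λ z (glue Λ τ (.fixed η)))) := by
  have hglue : glue Λ τ (.fixed (Function.update η z u)) =
      Function.update (glue Λ τ (.fixed η)) z u := by
    funext x
    by_cases hxz : x = z
    · subst hxz
      rw [Function.update_self, glue_apply_of_notMem _ _ _ hz, BoundaryCondition.outside_fixed,
        Function.update_self]
    · rw [Function.update_of_ne hxz]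
      by_cases hx : x ∈ Λ
      · rw [glue_apply_of_mem _ _ _ hx, glue_apply_of_mem _ _ _ hx]
      · rw [glue_apply_of_notMem _ _ _ hx, glue_apply_of_notMem _ _ _ hx,
          BoundaryCondition.outside_fixed, BoundaryCondition.outside_fixed, Function.update_of_ne hxz]
  have hz' : spinAt z (glue Λ τ (.fixed η)) = spinAt z η := by
    simp [spinAt, glue_apply_of_notMem _ _ _ hz]
  rw [isingWeight, isingWeight, ← Real.exp_add, hglue]
  congr 1
  simp only [isingHamiltonian, interactionEdges_fixed, zero_mul, sub_zero]
  have := sum_bondSpin_update_sub G hz (glue Λ τ (.fixed η)) u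
  rw [hz'] at this
  linear_combination β * this

/-! ### Unfixing one spin: the conditioning identity -/

/-- For a site `z ∉ Λ` all of whose neighbours lie in `Λ`, no edge touches `insert z Λ` without
touching `Λ`. [folklore] -/
theorem edgesTouching_insert_sdiff_eq_empty {Λ : Finset V} {z : V}
    (hN : ∀ y, G.Adj z y → y ∈ Λ) :
    edgesTouching G (insert z Λ) \ edgesTouching G Λ = ∅ := by
  refine Finset.sdiff_eq_empty_iff_subset.2 fun e he => ?_
  rw [mem_edgesTouching_iff] at he ⊢
  obtain ⟨he, x, hx, hxe⟩ := he
  rcases Finset.mem_insert.1 hx with rfl | hxΛ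
  · induction e using Sym2.ind with
    | _ a b =>
      have hadj : G.Adj a b := (SimpleGraph.mem_edgeSet G).1 he
      rcases Sym2.mem_iff.1 hxe with rfl | rfl
      · exact ⟨he, b, hN b hadj, Sym2.mem_mk_right _ _⟩
      · exact ⟨he, a, hN a hadj.symm, Sym2.mem_mk_left _ _⟩
  · exact ⟨he, x, hxΛ, hxe⟩

/-- **The two-layer Boltzmann sum for one unfixed spin.** For `z ∉ Λ` with all neighbours in `Λ`,
zero field and a boundary condition `η` with `η_z = +1`: summing first over the spin `u` at `z`,
`∑_τ w^η_{Λ ∪ {z}}(τ) F(τ·η) = ∑_{u = ±1} ∑_{τ₁} w^{η}_Λ(τ₁) e^{β(u-1)S_z(τ₁·η)} F((τ₁·η)[z ↦ u])`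
(van Enter–Fernández–Sokal eq. (4.7): the system with the origin unfixed in terms of the system
with the origin fixed to `+`). [cite: VanenterFernandezSokal1993, §4.1.2 Step 3, eq. (4.7)] -/
theorem sum_isingWeight_insert_eq {Λ : Finset V} {z : V} (hz : z ∉ Λ)
    (hN : ∀ y, G.Adj z y → y ∈ Λ) (β : ℝ) {η : SpinConfig V} (hη : η z = 1)
    (F : SpinConfig V → ℝ) :
    ∑ τ : ↥(insert z Λ) → ℤˣ, isingWeight G (insert z Λ) β 0 (.fixed η) τ *
        F (glue (insert z Λ) τ (.fixed η)) =
      ∑ u : ℤˣ, ∑ τ₁ : Λ → ℤˣ, isingWeight G Λ β 0 (.fixed η) τ₁ *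
        (Real.exp (β * ((((u : ℤ) : ℝ) - 1) * nbrSum G Λ z (glue Λ τ₁ (.fixed η)))) *
          F (Function.update (glue Λ τ₁ (.fixed η)) z u)) := by
  have hsub : Λ ⊆ insert z Λ := Finset.subset_insert z Λ
  have hsd : insert z Λ \ Λ = {z} := by
    ext x
    simp only [Finset.mem_sdiff, Finset.mem_insert, Finset.mem_singleton]
    constructor
    · rintro ⟨h | h, hx⟩
      · exact h
      · exact absurd h hx
    · rintro rfl
      exact ⟨Or.inl rfl, hz⟩
  have hzmem : z ∈ insert z Λ \ Λ := by rw [hsd]; exact Finset.mem_singleton_self z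
  rw [sum_isingWeight_fixed_eq_sum_sum G hsub η β 0 F, edgesTouching_insert_sdiff_eq_empty G hN]
  simp only [Finset.sum_empty, zero_mul, add_zero, mul_zero, Real.exp_zero, one_mul]
  -- functions on the one-point set `insert z Λ \ Λ = {z}` are spins `u`
  let e : ℤˣ ≃ (↥(insert z Λ \ Λ) → ℤˣ) :=
    { toFun := fun u _ => u
      invFun := fun τ₂ => τ₂ ⟨z, hzmem⟩
      left_inv := fun u => rfl
      right_inv := fun τ₂ => funext fun x => by
        have h2 := Finset.mem_sdiff.1 x.2
        have hx : x = ⟨z, hzmem⟩ :=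
          Subtype.ext ((Finset.mem_insert.1 h2.1).resolve_right h2.2)
        simp [hx] }
  rw [← Equiv.sum_comp e]
  refine Finset.sum_congr rfl fun u _ => ?_
  -- the boundary condition seen from `Λ` once `z` carries the spin `u`
  have hη₂ : glue (insert z Λ \ Λ) (e u) (.fixed η) = Function.update η z u := by
    funext x
    by_cases hxz : x = z
    · subst hxz
      rw [glue_apply_of_mem _ _ _ hzmem, Function.update_self]
      rfl
    · have hx : x ∉ insert z Λ \ Λ := by rw [hsd]; simpa using hxz
      rw [glue_apply_of_notMem _ _ _ hx, BoundaryCondition.outside_fixed, Function.update_of_ne hxz]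
  rw [hη₂]
  refine Finset.sum_congr rfl fun τ₁ _ => ?_
  have hglue : glue Λ τ₁ (.fixed (Function.update η z u)) =
      Function.update (glue Λ τ₁ (.fixed η)) z u := by
    funext x
    by_cases hxz : x = z
    · subst hxz
      rw [Function.update_self, glue_apply_of_notMem _ _ _ hz, BoundaryCondition.outside_fixed,
        Function.update_self]
    · rw [Function.update_of_ne hxz]
      by_cases hx : x ∈ Λ
      · rw [glue_apply_of_mem _ _ _ hx, glue_apply_of_mem _ _ _ hx]
      · rw [glue_apply_of_notMem _ _ _ hx, glue_apply_of_notMem _ _ _ hx,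
          BoundaryCondition.outside_fixed, BoundaryCondition.outside_fixed, Function.update_of_ne hxz]
  have hηz : spinAt z η = 1 := by simp [spinAt, hη]
  rw [isingWeight_fixed_update G hz β η u τ₁, hηz, hglue, mul_assoc]

/-- **The conditioning identity for one unfixed spin** (van Enter–Fernández–Sokal §4.1.2 Step 3,
eq. (4.7)): for `z ∉ Λ` with all neighbours in `Λ`, zero field and `η_z = +1`,
`⟨σ_z⟩^{η}_{Λ ∪ {z};β,0} = (1 - x)/(1 + x)` with `x = ⟨e^{-2β S_z}⟩^{η}_{Λ;β,0}` the expectation,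
in the system where `z` is a `+` boundary spin, of the relative Boltzmann weight of flipping it.
[cite: VanenterFernandezSokal1993, §4.1.2 Step 3, eq. (4.7)] -/
theorem isingExpect_spinAt_insert_eq {Λ : Finset V} {z : V} (hz : z ∉ Λ)
    (hN : ∀ y, G.Adj z y → y ∈ Λ) (β : ℝ) {η : SpinConfig V} (hη : η z = 1) :
    isingExpect G (insert z Λ) β 0 (.fixed η) (spinAt z) =
      (1 - isingExpect G Λ β 0 (.fixed η) (fun σ => Real.exp (-(2 * β) * nbrSum G Λ z σ))) /
        (1 + isingExpect G Λ β 0 (.fixed η) (fun σ => Real.exp (-(2 * β) * nbrSum G Λ z σ))) := by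
  have hgm : Measurable fun σ : SpinConfig V => Real.exp (-(2 * β) * nbrSum G Λ z σ) :=
    Real.measurable_exp.comp ((measurable_nbrSum G Λ z).const_mul _)
  set Z := isingPartitionFunction G Λ β 0 (.fixed η) with hZ
  set X := ∑ τ₁ : Λ → ℤˣ, isingWeight G Λ β 0 (.fixed η) τ₁ *
    Real.exp (-(2 * β) * nbrSum G Λ z (glue Λ τ₁ (.fixed η))) with hX
  have hZpos : 0 < Z := isingPartitionFunction_pos G Λ β 0 _
  have hXnn : 0 ≤ X := Finset.sum_nonneg fun τ₁ _ =>
    mul_nonneg (isingWeight_pos G Λ β 0 _ τ₁).le (Real.exp_pos _).le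
  -- numerator and denominator of `⟨σ_z⟩_{Λ ∪ {z}}`
  have hnum : ∑ τ : ↥(insert z Λ) → ℤˣ, isingWeight G (insert z Λ) β 0 (.fixed η) τ *
      spinAt z (glue (insert z Λ) τ (.fixed η)) = Z - X := by
    rw [sum_isingWeight_insert_eq G hz hN β hη (spinAt z), UnitsInt.univ,
      Finset.sum_pair (by decide), hZ, isingPartitionFunction, hX]
    have h2 : ∀ τ₁ : Λ → ℤˣ, isingWeight G Λ β 0 (.fixed η) τ₁ *
        (Real.exp (β * ((((((-1 : ℤˣ) : ℤ)) : ℝ) - 1) * nbrSum G Λ z (glue Λ τ₁ (.fixed η)))) *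
          spinAt z (Function.update (glue Λ τ₁ (.fixed η)) z (-1))) =
        -(isingWeight G Λ β 0 (.fixed η) τ₁ *
          Real.exp (-(2 * β) * nbrSum G Λ z (glue Λ τ₁ (.fixed η)))) := by
      intro τ₁
      simp only [spinAt, Function.update_self, Units.val_neg, Units.val_one, Int.cast_neg,
        Int.cast_one]
      have : β * ((-1 - 1) * nbrSum G Λ z (glue Λ τ₁ (.fixed η))) =
          -(2 * β) * nbrSum G Λ z (glue Λ τ₁ (.fixed η)) := by ring
      rw [this]
      ring
    have h1 : ∀ τ₁ : Λ → ℤˣ, isingWeight G Λ β 0 (.fixed η) τ₁ *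
        (Real.exp (β * ((((((1 : ℤˣ) : ℤ)) : ℝ) - 1) * nbrSum G Λ z (glue Λ τ₁ (.fixed η)))) *
          spinAt z (Function.update (glue Λ τ₁ (.fixed η)) z 1)) =
        isingWeight G Λ β 0 (.fixed η) τ₁ := by
      intro τ₁
      simp [spinAt, Function.update_self]
    simp only [h1, h2, Finset.sum_neg_distrib]
    ring
  have hden : ∑ τ : ↥(insert z Λ) → ℤˣ, isingWeight G (insert z Λ) β 0 (.fixed η) τ = Z + X := by
    have := sum_isingWeight_insert_eq G hz hN β hη (fun _ => 1)
    simp only [mul_one] at this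
    rw [this, UnitsInt.univ, Finset.sum_pair (by decide), hZ, isingPartitionFunction, hX]
    have h2 : ∀ τ₁ : Λ → ℤˣ, isingWeight G Λ β 0 (.fixed η) τ₁ *
        Real.exp (β * ((((((-1 : ℤˣ) : ℤ)) : ℝ) - 1) * nbrSum G Λ z (glue Λ τ₁ (.fixed η)))) =
        isingWeight G Λ β 0 (.fixed η) τ₁ *
          Real.exp (-(2 * β) * nbrSum G Λ z (glue Λ τ₁ (.fixed η))) := by
      intro τ₁
      simp only [Units.val_neg, Units.val_one, Int.cast_neg, Int.cast_one]
      have : β * ((-1 - 1) * nbrSum G Λ z (glue Λ τ₁ (.fixed η))) =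
          -(2 * β) * nbrSum G Λ z (glue Λ τ₁ (.fixed η)) := by ring
      rw [this]
    have h1 : ∀ τ₁ : Λ → ℤˣ, isingWeight G Λ β 0 (.fixed η) τ₁ *
        Real.exp (β * ((((((1 : ℤˣ) : ℤ)) : ℝ) - 1) * nbrSum G Λ z (glue Λ τ₁ (.fixed η)))) =
        isingWeight G Λ β 0 (.fixed η) τ₁ := by
      intro τ₁; simp
    simp only [h1, h2]
  have hx : isingExpect G Λ β 0 (.fixed η) (fun σ => Real.exp (-(2 * β) * nbrSum G Λ z σ)) = X / Z := by
    rw [isingExpect_eq_sum_div G Λ 0 _ β hgm]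
  rw [isingExpect, integral_isingMeasure G _ β 0 _ (measurable_spinAt z), hnum,
    isingPartitionFunction, hden, hx]
  field_simp

/-! ### Spin flip of a general observable at zero field -/

/-- **Global spin flip at zero field, for a general observable**: `⟨f⟩^{-η}_{Λ;β,0} =
⟨f(-·)⟩^{η}_{Λ;β,0}` (change of variables `τ ↦ -τ` in the finite Boltzmann sums; the spin-product
case is the tree's `isingCorr_fixed_flip`). This is the symmetry behind van Enter–Fernández–Sokal's
(4.8): "for the analogous system with the image spins … set to '-', we have …".
[cite: VanenterFernandezSokal1993, §4.1.2 Step 3, eq. (4.8)] [cite: FriedliVelenik2017, §3.7.1] -/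
theorem isingExpect_fixed_neg_bc (Λ : Finset V) (β : ℝ) (η : SpinConfig V) {f : SpinConfig V → ℝ}
    (hf : Measurable f) :
    isingExpect G Λ β 0 (.fixed (-η)) f = isingExpect G Λ β 0 (.fixed η) (fun σ => f (-σ)) := by
  have hfn : Measurable fun σ : SpinConfig V => f (-σ) := hf.comp measurable_neg
  have hZ : isingPartitionFunction G Λ β 0 (.fixed (-η)) = isingPartitionFunction G Λ β 0 (.fixed η) := by
    have := isingPartitionFunction_flip G Λ β 0 (.fixed η)
    rwa [neg_zero, BoundaryCondition.flip_fixed] at this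
  rw [isingExpect_eq_sum_div G Λ 0 _ β hf, isingExpect_eq_sum_div G Λ 0 _ β hfn, hZ]
  congr 1
  refine Fintype.sum_equiv (Equiv.neg _) _ _ fun τ => ?_
  have hw := isingWeight_neg_flip G Λ β 0 (.fixed η) (-τ)
  rw [neg_zero, BoundaryCondition.flip_fixed, neg_neg] at hw
  rw [Equiv.neg_apply, ← hw, ← glue_neg_fixed Λ (-τ) η, neg_neg]

/-! ### A GKS lower bound for `⟨e^{tS} - e^{-tS}⟩⁺` -/

/-- The sum of the spins in a finite set, `S_N(σ) = ∑_{y ∈ N} σ_y`. [folklore] -/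
def spinTotal (N : Finset V) (σ : SpinConfig V) : ℝ := ∑ y ∈ N, spinAt y σ

omit [DecidableEq V] in
/-- `S_N` is measurable. [folklore] -/
@[fun_prop]
theorem measurable_spinTotal (N : Finset V) : Measurable (spinTotal N) :=
  Finset.measurable_sum _ fun y _ => measurable_spinAt y

omit [DecidableEq V] in
/-- `S_N` is nondecreasing. [folklore] -/
theorem spinTotal_mono (N : Finset V) : Monotone (spinTotal N) :=
  fun _ _ h => Finset.sum_le_sum fun y _ => spinAt_mono y h

omit [DecidableEq V] in
/-- `S_N(-σ) = -S_N(σ)`. [folklore] -/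
theorem spinTotal_neg (N : Finset V) (σ : SpinConfig V) : spinTotal N (-σ) = -spinTotal N σ := by
  simp only [spinTotal, spinAt_neg, Finset.sum_neg_distrib]

omit [DecidableEq V] in
/-- `|S_N| ≤ #N`. [folklore] -/
theorem abs_spinTotal_le (N : Finset V) (σ : SpinConfig V) : |spinTotal N σ| ≤ #N := by
  unfold spinTotal
  calc |∑ y ∈ N, spinAt y σ| ≤ ∑ y ∈ N, |spinAt y σ| := Finset.abs_sum_le_sum_abs _ _
    _ ≤ ∑ y ∈ N, (1 : ℝ) := Finset.sum_le_sum fun y _ => by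
        rcases spinAt_eq_one_or_eq_neg_one y σ with h | h <;> simp [h]
    _ = #N := by simp

omit [DecidableEq V] in
/-- `S_N` reads only the spins in `N`. [folklore] -/
theorem spinTotal_congr (N : Finset V) {σ σ' : SpinConfig V} (h : ∀ x ∈ N, σ x = σ' x) :
    spinTotal N σ = spinTotal N σ' :=
  Finset.sum_congr rfl fun y hy => by simp only [spinAt, h y hy]

/-- The neighbour sum is the spin sum of the neighbours inside `Λ`. [folklore] -/
theorem nbrSum_eq_spinTotal (Λ : Finset V) (z : V) :
    nbrSum G Λ z = spinTotal (Λ ∩ G.neighborFinset z) := rfl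

omit [DecidableEq V] in
/-- `e^{t σ_y} = cosh t + σ_y sinh t` for a single spin. [folklore] -/
theorem exp_mul_spinAt (t : ℝ) (y : V) (σ : SpinConfig V) :
    Real.exp (t * spinAt y σ) = Real.cosh t + Real.sinh t * spinAt y σ := by
  rcases spinAt_eq_one_or_eq_neg_one y σ with h | h
  · rw [h, mul_one, mul_one, Real.cosh_add_sinh]
  · rw [h, mul_neg_one, mul_neg_one, ← sub_eq_add_neg, Real.cosh_sub_sinh]

/-- **Expansion of `e^{t S_N}` into spin products**: `e^{t S_N} = ∏_{y ∈ N}(cosh t + σ_y sinh t)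
= ∑_{A ⊆ N} cosh^{|N ∖ A|} t · sinh^{|A|} t · σ_A` (van Enter–Fernández–Sokal eq. (4.12): the
expansion of `sinh 2J(σ_{0,1}+σ_{0,-1}+σ_{1,0}+σ_{-1,0})` in odd powers).
[cite: VanenterFernandezSokal1993, §4.1.2 Step 3, eq. (4.12)] -/
theorem exp_mul_spinTotal_eq_sum (t : ℝ) (N : Finset V) (σ : SpinConfig V) :
    Real.exp (t * spinTotal N σ) =
      ∑ A ∈ N.powerset, Real.cosh t ^ #(N \ A) * Real.sinh t ^ #A * spinProduct A σ := by
  rw [spinTotal, Finset.mul_sum, Real.exp_sum]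
  simp_rw [exp_mul_spinAt]
  have : ∏ y ∈ N, (Real.cosh t + Real.sinh t * spinAt y σ) =
      ∏ y ∈ N, (Real.sinh t * spinAt y σ + Real.cosh t) :=
    Finset.prod_congr rfl fun y _ => add_comm _ _
  rw [this, Finset.prod_add]
  refine Finset.sum_congr rfl fun A _ => ?_
  rw [Finset.prod_mul_distrib, Finset.prod_const, Finset.prod_const, spinProduct]
  ring

/-- **The GKS lower bound behind (4.12)–(4.13)**: in a `+` state at zero field with `β ≥ 0`, for
`t ≥ 0`, a finite set `N ⊆ Λ` of sites and `y₀ ∈ N`,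
`⟨e^{t S_N} - e^{-t S_N}⟩⁺_{Λ;β,0} ≥ 2 cosh^{|N|-1} t · sinh t · ⟨σ_{y₀}⟩⁺_{Λ;β,0}`: in the expansion
of the difference only odd `|A|` survive, with nonnegative coefficients, and `⟨σ_A⟩⁺ ≥ 0` by the
first Griffiths inequality, so the difference is at least its `A = {y₀}` term ("since the
contributions from `k = 3, 5, …` are all nonnegative by Griffiths' first inequality", (4.12)).
[cite: VanenterFernandezSokal1993, §4.1.2 Step 3, eqs. (4.12)–(4.13)] -/
theorem isingExpect_exp_spinTotal_sub_ge {Λ N : Finset V} (hN : N ⊆ Λ) {y₀ : V} (hy₀ : y₀ ∈ N)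
    {β t : ℝ} (hβ : 0 ≤ β) (ht : 0 ≤ t) :
    2 * Real.cosh t ^ (#N - 1) * Real.sinh t * isingExpect G Λ β 0 .plus (spinAt y₀) ≤
      isingExpect G Λ β 0 .plus
        (fun σ => Real.exp (t * spinTotal N σ) - Real.exp (-t * spinTotal N σ)) := by
  -- coefficients of the expansion of the difference
  set c : Finset V → ℝ := fun A =>
    Real.cosh t ^ #(N \ A) * (Real.sinh t ^ #A - (-Real.sinh t) ^ #A) with hc
  have hdiff : (fun σ : SpinConfig V => Real.exp (t * spinTotal N σ) - Real.exp (-t * spinTotal N σ)) =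
      fun σ => ∑ A ∈ N.powerset, c A * spinProduct A σ := by
    funext σ
    rw [exp_mul_spinTotal_eq_sum, exp_mul_spinTotal_eq_sum, Real.cosh_neg, Real.sinh_neg,
      ← Finset.sum_sub_distrib]
    refine Finset.sum_congr rfl fun A _ => ?_
    simp only [hc]
    ring
  have hc_nonneg : ∀ A, 0 ≤ c A := fun A => by
    simp only [hc]
    refine mul_nonneg (pow_nonneg (Real.cosh_pos t).le _) ?_
    rw [neg_pow]
    rcases neg_one_pow_eq_or ℝ #A with h | h <;> rw [h]
    · simp
    · have := pow_nonneg (Real.sinh_nonneg_iff.2 ht) #A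
      linarith
  have hcy : c {y₀} = 2 * Real.cosh t ^ (#N - 1) * Real.sinh t := by
    simp only [hc, Finset.card_singleton, pow_one, sub_neg_eq_add]
    rw [Finset.card_sdiff_of_subset (Finset.singleton_subset_iff.2 hy₀), Finset.card_singleton]
    ring
  rw [hdiff, isingExpect_finset_sum' G Λ 0 .plus β N.powerset _
    (fun A => (measurable_spinProduct A).const_mul (c A))]
  simp_rw [isingExpect_const_mul' G Λ 0 .plus β _ (measurable_spinProduct _)]
  have hterm : ∀ A ∈ N.powerset, 0 ≤ c A * isingExpect G Λ β 0 .plus (spinProduct A) :=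
    fun A hA => mul_nonneg (hc_nonneg A)
      (GriffithsKellySherman.gks_one_holds G hβ le_rfl (Or.inr rfl)
        ((Finset.mem_powerset.1 hA).trans hN))
  have hmem : {y₀} ∈ N.powerset := Finset.mem_powerset.2 (Finset.singleton_subset_iff.2 hy₀)
  calc 2 * Real.cosh t ^ (#N - 1) * Real.sinh t * isingExpect G Λ β 0 .plus (spinAt y₀)
      = c {y₀} * isingExpect G Λ β 0 .plus (spinProduct {y₀}) := by
        rw [hcy, spinProduct_singleton]
    _ ≤ ∑ A ∈ N.powerset, c A * isingExpect G Λ β 0 .plus (spinProduct A) :=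
        Finset.single_le_sum hterm hmem

end Literature.Probability.LatticeModels

end
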